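import Literature.NumberTheory.Automorphic.PositiveFormSchurCoordinates
import HarnessLib

/-!
# A convex open cone sandwiched between two Siegel sets of positive forms

Topic `NumberTheory/Automorphic` (reduction theory of positive forms); namespace
`Literature.NumberTheory.Automorphic`, grouping sub-namespace `PosForm`.  Definitions with bodies
and theorems; one place (an `RCLike` field `𝕜`), no named fact, no `sorry`.  Sequel of
`PositiveFormSchurCoordinates`.

Let `𝔅(c, t)` be the Siegel set of the upper triangular Borel subgroup of `GL_n(𝕜)`
(`upperSiegel`): upper triangular `b` with non-zero diagonal, `|b_{ij}| ≤ c |b_{jj}|` for `i < j`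
and `t |b_{i+1,i+1}|² ≤ |b_{ii}|²` ([Borel1969, §1.2–1.4, Déf. 4.4]; [GetzHahn2024, (2.16)–(2.17)]
in the coordinates `b = u · a`, `u` unipotent, `a` diagonal).  Its image `{b bᴴ}` in the cone of
positive definite forms (`g` acting by `P ↦ g P gᴴ`, base point the identity form) is in general
NOT convex for `n ≥ 3`.  The set

  `V(c₁, t') = {P ≻ 0 : t' Re P_{i+1,i+1} < d_i(P),  |P_{ij}| < c₁ d_j(P) (i < j)}`

(`sandwich`), cut out by super-level conditions of the concave Schur coordinates `d_i`
(`PositiveFormSchurCoordinates`), IS an open convex cone (`convex_sandwich`, `isOpen_sandwich`,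
`smul_mem_sandwich`), and it is sandwiched between two Siegel images:

* `mul_conjTranspose_mem_sandwich` — `b ∈ 𝔅(c, t)` implies `b bᴴ ∈ V(c₁, t')` as soon as
  `c₁ > c + c² n t⁻ⁿ` and `t' (1 + c² n t⁻ⁿ) < t`;
* `mem_upperSiegel_of_mul_conjTranspose_mem_sandwich` — if `b` is upper triangular with non-zero
  diagonal and `b bᴴ ∈ V(c₁, t')` (`0 < t' ≤ 1`), then `b ∈ 𝔅(c*, t')` with the explicit constant
  `c* = outerConst c₁ t'⁻ⁿ n` (a downward induction on the columns).

Consequently (sequel files) the translates of `V` by an arithmetic group inherit BOTH the covering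
property of Siegel sets (reduction theory) and their Siegel finiteness property, while finite
intersections of translates are convex, hence contractible: the input of the equivariant
good-cover form of Brown's finiteness criterion.

## References

* A. Borel, *Introduction aux groupes arithmétiques*, Hermann (1969), §1.2–1.4, §4 (Siegel sets).
  [Borel1969]
* J. R. Getz, H. Hahn, *An Introduction to Automorphic Representations*, GTM 300 (2024), §2.7
  (2.16)–(2.17). [GetzHahn2024]
-/

noncomputable section

open Matrix
open scoped ComplexOrder

namespace Literature.NumberTheory.Automorphic

namespace PosForm

variable {𝕜 : Type*} [RCLike 𝕜] {n : ℕ}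

/-! ### The two sets -/

/-- **The Siegel set of the upper triangular Borel subgroup** (one place): upper triangular `b`
with non-zero diagonal entries, `|b_{ij}| ≤ c |b_{jj}|` for `i < j` (bounded unipotent
coordinates) and `t |b_{i+1,i+1}|² ≤ |b_{ii}|²` (simple roots bounded below).
[cite: Borel1969, §1.2–1.4 and Déf. 4.4] -/
def upperSiegel (c t : ℝ) : Set (Matrix (Fin n) (Fin n) 𝕜) :=
  {b | b.BlockTriangular id ∧ (∀ i, b i i ≠ 0) ∧ (∀ i j, i < j → ‖b i j‖ ≤ c * ‖b j j‖) ∧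
    ∀ i j : Fin n, (j : ℕ) = i + 1 → t * ‖b j j‖ ^ 2 ≤ ‖b i i‖ ^ 2}

/-- Membership in the Siegel set, unfolded. [cite: Borel1969, §1.2–1.4 and Déf. 4.4] -/
theorem mem_upperSiegel_iff {c t : ℝ} {b : Matrix (Fin n) (Fin n) 𝕜} :
    b ∈ upperSiegel c t ↔ b.BlockTriangular id ∧ (∀ i, b i i ≠ 0) ∧
      (∀ i j, i < j → ‖b i j‖ ≤ c * ‖b j j‖) ∧
      ∀ i j : Fin n, (j : ℕ) = i + 1 → t * ‖b j j‖ ^ 2 ≤ ‖b i i‖ ^ 2 :=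
  Iff.rfl

/-- The Siegel sets grow when `c` grows and `t` shrinks. [folklore] -/
theorem upperSiegel_mono {c c' t t' : ℝ} (hc : c ≤ c') (ht : t' ≤ t) :
    (upperSiegel c t : Set (Matrix (Fin n) (Fin n) 𝕜)) ⊆ upperSiegel c' t' := by
  rintro b ⟨h1, h2, h3, h4⟩
  refine ⟨h1, h2, fun i j hij => (h3 i j hij).trans
    (mul_le_mul_of_nonneg_right hc (norm_nonneg _)), fun i j hij => le_trans ?_ (h4 i j hij)⟩
  exact mul_le_mul_of_nonneg_right ht (sq_nonneg _)

/-- **The convex body `V(c₁, t')`**: positive definite `P` with `t' Re P_{i+1,i+1} < d_i(P)` and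
`|P_{ij}| < c₁ d_j(P)` for `i < j`. [cite: Borel1969, §1.2–1.4] -/
def sandwich (c₁ t' : ℝ) : Set (Matrix (Fin n) (Fin n) 𝕜) :=
  {P | P.PosDef ∧ (∀ i j : Fin n, (j : ℕ) = i + 1 → t' * RCLike.re (P j j) < schurDiag P i) ∧
    ∀ i j : Fin n, i < j → ‖P i j‖ < c₁ * schurDiag P j}

/-- Membership in the convex body, unfolded. [cite: Borel1969, §1.2–1.4] -/
theorem mem_sandwich_iff {c₁ t' : ℝ} {P : Matrix (Fin n) (Fin n) 𝕜} :
    P ∈ sandwich c₁ t' ↔ P.PosDef ∧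
      (∀ i j : Fin n, (j : ℕ) = i + 1 → t' * RCLike.re (P j j) < schurDiag P i) ∧
      ∀ i j : Fin n, i < j → ‖P i j‖ < c₁ * schurDiag P j :=
  Iff.rfl

/-! ### `V` is an open convex cone -/

/-- **`V(c₁, t')` is convex** (for `c₁ ≥ 0`): each defining condition is a super-level condition
of a concave `d_i` against a linear (resp. convex) function. [folklore] -/
theorem convex_sandwich {c₁ : ℝ} (hc₁ : 0 ≤ c₁) (t' : ℝ) :
    Convex ℝ (sandwich c₁ t' : Set (Matrix (Fin n) (Fin n) 𝕜)) := by
  intro P hP Q hQ a b ha hb hab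
  refine ⟨convex_setOf_posDef hP.1 hQ.1 ha hb hab, fun i j hij => ?_, fun i j hij => ?_⟩
  · let ℓ : Matrix (Fin n) (Fin n) 𝕜 →ₗ[ℝ] ℝ := t' • (RCLike.reLm.comp (entryLinearMap ℝ 𝕜 j j))
    have hℓ : ∀ M : Matrix (Fin n) (Fin n) 𝕜, ℓ M = t' * RCLike.re (M j j) := fun M => rfl
    have h := (convex_setOf_lt_schurDiag ℓ i (x := P) ⟨hP.1, by rw [hℓ]; exact hP.2.1 i j hij⟩
      (y := Q) ⟨hQ.1, by rw [hℓ]; exact hQ.2.1 i j hij⟩ ha hb hab).2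
    rwa [hℓ] at h
  · let ℓ : Matrix (Fin n) (Fin n) 𝕜 →ₗ[ℝ] 𝕜 := entryLinearMap ℝ 𝕜 i j
    have hℓ : ∀ M : Matrix (Fin n) (Fin n) 𝕜, ℓ M = M i j := fun M => rfl
    have h := (convex_setOf_norm_lt_mul_schurDiag ℓ hc₁ j (x := P)
      ⟨hP.1, by rw [hℓ]; exact hP.2.2 i j hij⟩ (y := Q) ⟨hQ.1, by rw [hℓ]; exact hQ.2.2 i j hij⟩
      ha hb hab).2
    rwa [hℓ] at h

/-- **`V(c₁, t')` is open in the positive definite cone** (for `c₁ > 0`): lower semicontinuity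
of the `d_i`. [folklore] -/
theorem isOpen_sandwich {c₁ : ℝ} (hc₁ : 0 < c₁) (t' : ℝ) :
    IsOpen {x : {P : Matrix (Fin n) (Fin n) 𝕜 // P.PosDef} | x.1 ∈ sandwich c₁ t'} := by
  -- the two families of conditions, one condition at a time
  have hC : ∀ i j : Fin n, IsOpen {x : {P : Matrix (Fin n) (Fin n) 𝕜 // P.PosDef} |
      (j : ℕ) = i + 1 → t' * RCLike.re (x.1 j j) < schurDiag x.1 i} := by
    intro i j
    by_cases hij : (j : ℕ) = i + 1
    · have hα : Continuous fun x : {P : Matrix (Fin n) (Fin n) 𝕜 // P.PosDef} =>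
          t' * RCLike.re (x.1 j j) :=
        continuous_const.mul (RCLike.continuous_re.comp (continuous_subtype_val.matrix_elem j j))
      have h := isOpen_setOf_lt_schurDiag hα i
      convert h using 1
      ext x
      exact ⟨fun hx => hx hij, fun hx _ => hx⟩
    · convert isOpen_univ
      ext x
      simp only [Set.mem_setOf_eq, Set.mem_univ, iff_true]
      exact fun h => absurd h hij
  have hL : ∀ i j : Fin n, IsOpen {x : {P : Matrix (Fin n) (Fin n) 𝕜 // P.PosDef} |
      i < j → ‖x.1 i j‖ / c₁ < schurDiag x.1 j} := by
    intro i j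
    by_cases hij : i < j
    · have hα : Continuous fun x : {P : Matrix (Fin n) (Fin n) 𝕜 // P.PosDef} => ‖x.1 i j‖ / c₁ :=
        ((continuous_subtype_val.matrix_elem i j).norm).div_const c₁
      have h := isOpen_setOf_lt_schurDiag hα j
      convert h using 1
      ext x
      exact ⟨fun hx => hx hij, fun hx _ => hx⟩
    · convert isOpen_univ
      ext x
      simp only [Set.mem_setOf_eq, Set.mem_univ, iff_true]
      exact fun h => absurd h hij
  have hEq : {x : {P : Matrix (Fin n) (Fin n) 𝕜 // P.PosDef} | x.1 ∈ sandwich c₁ t'} =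
      (⋂ i : Fin n, ⋂ j : Fin n,
        {x | (j : ℕ) = i + 1 → t' * RCLike.re (x.1 j j) < schurDiag x.1 i}) ∩
      ⋂ i : Fin n, ⋂ j : Fin n, {x | i < j → ‖x.1 i j‖ / c₁ < schurDiag x.1 j} := by
    ext x
    simp only [Set.mem_setOf_eq, mem_sandwich_iff, Set.mem_inter_iff, Set.mem_iInter,
      div_lt_iff₀ hc₁]
    constructor
    · rintro ⟨-, h1, h2⟩
      exact ⟨h1, fun i j hij => by rw [mul_comm]; exact h2 i j hij⟩
    · rintro ⟨h1, h2⟩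
      exact ⟨x.2, h1, fun i j hij => by rw [mul_comm]; exact h2 i j hij⟩
  rw [hEq]
  exact (isOpen_iInter_of_finite fun i => isOpen_iInter_of_finite fun j => hC i j).inter
    (isOpen_iInter_of_finite fun i => isOpen_iInter_of_finite fun j => hL i j)

/-- **`V(c₁, t')` is a cone**: stable under positive real scalars. [folklore] -/
theorem smul_mem_sandwich {c₁ t' : ℝ} {P : Matrix (Fin n) (Fin n) 𝕜} (hP : P ∈ sandwich c₁ t')
    {s : ℝ} (hs : 0 < s) : s • P ∈ sandwich c₁ t' := by
  refine ⟨posDef_smul hP.1 hs, fun i j hij => ?_, fun i j hij => ?_⟩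
  · rw [schurDiag_smul hs.le, Matrix.smul_apply, RCLike.smul_re, mul_left_comm]
    exact mul_lt_mul_of_pos_left (hP.2.1 i j hij) hs
  · rw [schurDiag_smul hs.le, Matrix.smul_apply, norm_smul, Real.norm_of_nonneg hs.le, mul_left_comm]
    exact mul_lt_mul_of_pos_left (hP.2.2 i j hij) hs

/-! ### Chains of root inequalities -/

/-- **Iterating the simple-root bounds**: if `t D_{i+1} ≤ D_i` for all consecutive indices, with
`0 < t ≤ 1` and `D ≥ 0`, then `D_k ≤ t⁻ⁿ D_j` for all `j ≤ k`. [folklore] -/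
theorem le_inv_pow_mul_of_chain {D : Fin n → ℝ} {t : ℝ} (ht : 0 < t) (ht1 : t ≤ 1)
    (hD : ∀ i, 0 ≤ D i) (h : ∀ i j : Fin n, (j : ℕ) = i + 1 → t * D j ≤ D i) {j k : Fin n}
    (hjk : j ≤ k) : D k ≤ (t⁻¹) ^ n * D j := by
  have hti : 1 ≤ t⁻¹ := one_le_inv_iff₀.mpr ⟨ht, ht1⟩
  -- by induction on the distance `d = k - j`
  have key : ∀ d : ℕ, ∀ j k : Fin n, (k : ℕ) = j + d → D k ≤ (t⁻¹) ^ d * D j := by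
    intro d
    induction d with
    | zero =>
      intro j k hk
      rw [add_zero] at hk
      rw [Fin.ext hk, pow_zero, one_mul]
    | succ d ih =>
      intro j k hk
      have hk' : (j : ℕ) + d < n := by omega
      set k' : Fin n := ⟨(j : ℕ) + d, hk'⟩ with hk'def
      have h1 : D k ≤ t⁻¹ * D k' := by
        rw [le_inv_mul_iff₀ ht]
        exact h k' k (by rw [hk, hk'def]; rfl)
      have h2 : D k' ≤ (t⁻¹) ^ d * D j := ih j k' rfl
      calc D k ≤ t⁻¹ * D k' := h1
        _ ≤ t⁻¹ * ((t⁻¹) ^ d * D j) := mul_le_mul_of_nonneg_left h2 (inv_nonneg.mpr ht.le)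
        _ = (t⁻¹) ^ (d + 1) * D j := by ring
  obtain ⟨d, hd⟩ : ∃ d : ℕ, (k : ℕ) = j + d := ⟨k - j, by have := Fin.le_def.mp hjk; omega⟩
  have hdn : d ≤ n := by have := k.2; omega
  calc D k ≤ (t⁻¹) ^ d * D j := key d j k hd
    _ ≤ (t⁻¹) ^ n * D j := mul_le_mul_of_nonneg_right (pow_le_pow_right₀ hti hdn) (hD j)

/-! ### Auxiliary finite sums over the columns after `j` -/

omit [RCLike 𝕜] in
/-- The columns `≥ j` are `j` and the columns `> j`. [folklore] -/
private theorem filter_le_eq (j : Fin n) :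
    Finset.univ.filter (fun k : Fin n => j ≤ k) = insert j (Finset.univ.filter fun k => j < k) := by
  ext k
  simp only [Finset.mem_filter, Finset.mem_univ, true_and, Finset.mem_insert]
  constructor
  · intro h
    rcases h.eq_or_lt with h | h
    · exact Or.inl h.symm
    · exact Or.inr h
  · rintro (rfl | h)
    · exact le_rfl
    · exact h.le

omit [RCLike 𝕜] in
/-- `j` is not a column `> j`. [folklore] -/
private theorem notMem_filter_lt (j : Fin n) : j ∉ Finset.univ.filter fun k : Fin n => j < k := by
  simp

omit [RCLike 𝕜] in
/-- There are at most `n - 1 - j` columns `> j`. [folklore] -/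
private theorem card_filter_lt_le (j : Fin n) :
    ((Finset.univ.filter fun k : Fin n => j < k).card : ℝ) ≤ n - 1 - (j : ℕ) := by
  have h : Finset.univ.filter (fun k : Fin n => j < k) = Finset.Ioi j := by ext; simp
  rw [h, Fin.card_Ioi]
  have := j.2
  rw [Nat.cast_sub (by omega), Nat.cast_sub (by omega)]
  simp

/-! ### The inner inclusion `𝔅(c, t) · x₀ ⊆ V(c₁, t')` -/

/-- **Diagonal entries of `b bᴴ` on a Siegel set**: `Re (b bᴴ)_{jj} ≤ (1 + c² n t⁻ⁿ) |b_{jj}|²`.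
[cite: Borel1969, §1.2–1.4] -/
theorem re_mul_conjTranspose_apply_self_le {c t : ℝ} (ht : 0 < t) (ht1 : t ≤ 1)
    {b : Matrix (Fin n) (Fin n) 𝕜} (hb : b ∈ upperSiegel c t) (j : Fin n) :
    RCLike.re ((b * bᴴ) j j) ≤ (1 + c ^ 2 * n * (t⁻¹) ^ n) * ‖b j j‖ ^ 2 := by
  obtain ⟨htri, hdiag, hoff, hroot⟩ := hb
  set T : ℝ := (t⁻¹) ^ n with hT
  have hT0 : 0 ≤ T := pow_nonneg (inv_nonneg.mpr ht.le) n
  have hchain : ∀ j k : Fin n, j ≤ k → ‖b k k‖ ^ 2 ≤ T * ‖b j j‖ ^ 2 := fun j k hjk =>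
    le_inv_pow_mul_of_chain (D := fun i => ‖b i i‖ ^ 2) ht ht1 (fun _ => sq_nonneg _) hroot hjk
  rw [re_mul_conjTranspose_apply_self_eq_sum_filter htri, filter_le_eq,
    Finset.sum_insert (notMem_filter_lt j)]
  have hsum : ∑ k ∈ Finset.univ.filter (fun k : Fin n => j < k), ‖b j k‖ ^ 2 ≤
      ∑ _k ∈ Finset.univ.filter (fun k : Fin n => j < k), c ^ 2 * T * ‖b j j‖ ^ 2 := by
    refine Finset.sum_le_sum fun k hk => ?_
    have hjk : j < k := (Finset.mem_filter.mp hk).2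
    calc ‖b j k‖ ^ 2 ≤ (c * ‖b k k‖) ^ 2 :=
          pow_le_pow_left₀ (norm_nonneg _) (hoff j k hjk) 2
      _ = c ^ 2 * ‖b k k‖ ^ 2 := by ring
      _ ≤ c ^ 2 * (T * ‖b j j‖ ^ 2) := mul_le_mul_of_nonneg_left (hchain j k hjk.le) (sq_nonneg c)
      _ = c ^ 2 * T * ‖b j j‖ ^ 2 := by ring
  rw [Finset.sum_const, nsmul_eq_mul] at hsum
  have hcard := card_filter_lt_le (n := n) j
  have hn : ((Finset.univ.filter fun k : Fin n => j < k).card : ℝ) ≤ n := by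
    refine hcard.trans ?_
    have := j.2
    linarith [(Nat.cast_nonneg (j : ℕ) : (0 : ℝ) ≤ (j : ℕ))]
  have hnn : 0 ≤ c ^ 2 * T * ‖b j j‖ ^ 2 := by positivity
  calc ‖b j j‖ ^ 2 + ∑ k ∈ Finset.univ.filter (fun k : Fin n => j < k), ‖b j k‖ ^ 2
      ≤ ‖b j j‖ ^ 2 + ((Finset.univ.filter fun k : Fin n => j < k).card : ℝ) *
          (c ^ 2 * T * ‖b j j‖ ^ 2) := by linarith
    _ ≤ ‖b j j‖ ^ 2 + (n : ℝ) * (c ^ 2 * T * ‖b j j‖ ^ 2) := by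
        linarith [mul_le_mul_of_nonneg_right hn hnn]
    _ = (1 + c ^ 2 * n * T) * ‖b j j‖ ^ 2 := by ring

/-- **Lower bound for the diagonal entries of `b bᴴ`**, `b` upper triangular:
`|b_{jj}|² ≤ Re (b bᴴ)_{jj}`. [folklore] -/
theorem norm_sq_le_re_mul_conjTranspose_apply_self {b : Matrix (Fin n) (Fin n) 𝕜}
    (hb : b.BlockTriangular id) (j : Fin n) : ‖b j j‖ ^ 2 ≤ RCLike.re ((b * bᴴ) j j) := by
  rw [re_mul_conjTranspose_apply_self_eq_sum_filter hb]
  exact Finset.single_le_sum (f := fun k => ‖b j k‖ ^ 2) (fun _ _ => sq_nonneg _)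
    (Finset.mem_filter.mpr ⟨Finset.mem_univ j, le_rfl⟩)

/-- **Off-diagonal entries of `b bᴴ` on a Siegel set**: `|(b bᴴ)_{ij}| ≤ (c + c² n t⁻ⁿ) |b_{jj}|²`
for `i < j`. [cite: Borel1969, §1.2–1.4] -/
theorem norm_mul_conjTranspose_apply_le_of_mem_upperSiegel {c t : ℝ} (hc : 0 ≤ c) (ht : 0 < t)
    (ht1 : t ≤ 1) {b : Matrix (Fin n) (Fin n) 𝕜} (hb : b ∈ upperSiegel c t) {i j : Fin n}
    (hij : i < j) : ‖(b * bᴴ) i j‖ ≤ (c + c ^ 2 * n * (t⁻¹) ^ n) * ‖b j j‖ ^ 2 := by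
  obtain ⟨htri, hdiag, hoff, hroot⟩ := hb
  set T : ℝ := (t⁻¹) ^ n with hT
  have hT0 : 0 ≤ T := pow_nonneg (inv_nonneg.mpr ht.le) n
  have hchain : ∀ j k : Fin n, j ≤ k → ‖b k k‖ ^ 2 ≤ T * ‖b j j‖ ^ 2 := fun j k hjk =>
    le_inv_pow_mul_of_chain (D := fun i => ‖b i i‖ ^ 2) ht ht1 (fun _ => sq_nonneg _) hroot hjk
  refine (norm_mul_conjTranspose_apply_le htri i j).trans ?_
  rw [filter_le_eq, Finset.sum_insert (notMem_filter_lt j)]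
  have h1 : ‖b i j‖ * ‖b j j‖ ≤ c * ‖b j j‖ ^ 2 := by
    calc ‖b i j‖ * ‖b j j‖ ≤ c * ‖b j j‖ * ‖b j j‖ :=
          mul_le_mul_of_nonneg_right (hoff i j hij) (norm_nonneg _)
      _ = c * ‖b j j‖ ^ 2 := by ring
  have hsum : ∑ k ∈ Finset.univ.filter (fun k : Fin n => j < k), ‖b i k‖ * ‖b j k‖ ≤
      ∑ _k ∈ Finset.univ.filter (fun k : Fin n => j < k), c ^ 2 * T * ‖b j j‖ ^ 2 := by
    refine Finset.sum_le_sum fun k hk => ?_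
    have hjk : j < k := (Finset.mem_filter.mp hk).2
    have hik : i < k := hij.trans hjk
    calc ‖b i k‖ * ‖b j k‖ ≤ c * ‖b k k‖ * (c * ‖b k k‖) :=
          mul_le_mul (hoff i k hik) (hoff j k hjk) (norm_nonneg _)
            (mul_nonneg hc (norm_nonneg _))
      _ = c ^ 2 * ‖b k k‖ ^ 2 := by ring
      _ ≤ c ^ 2 * (T * ‖b j j‖ ^ 2) := mul_le_mul_of_nonneg_left (hchain j k hjk.le) (sq_nonneg c)
      _ = c ^ 2 * T * ‖b j j‖ ^ 2 := by ring
  rw [Finset.sum_const, nsmul_eq_mul] at hsum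
  have hcard := card_filter_lt_le (n := n) j
  have hn : ((Finset.univ.filter fun k : Fin n => j < k).card : ℝ) ≤ n := by
    refine hcard.trans ?_
    have := j.2
    linarith [(Nat.cast_nonneg (j : ℕ) : (0 : ℝ) ≤ (j : ℕ))]
  have hnn : 0 ≤ c ^ 2 * T * ‖b j j‖ ^ 2 := by positivity
  calc ‖b i j‖ * ‖b j j‖ + ∑ k ∈ Finset.univ.filter (fun k : Fin n => j < k), ‖b i k‖ * ‖b j k‖
      ≤ c * ‖b j j‖ ^ 2 + ((Finset.univ.filter fun k : Fin n => j < k).card : ℝ) *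
          (c ^ 2 * T * ‖b j j‖ ^ 2) := by linarith
    _ ≤ c * ‖b j j‖ ^ 2 + (n : ℝ) * (c ^ 2 * T * ‖b j j‖ ^ 2) := by
        linarith [mul_le_mul_of_nonneg_right hn hnn]
    _ = (c + c ^ 2 * n * T) * ‖b j j‖ ^ 2 := by ring

/-- `b bᴴ` is positive definite for `b` upper triangular with non-zero diagonal. [folklore] -/
theorem posDef_mul_conjTranspose {b : Matrix (Fin n) (Fin n) 𝕜} (hb : b.BlockTriangular id)
    (hd : ∀ i, b i i ≠ 0) : (b * bᴴ).PosDef :=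
  PosDef.mul_conjTranspose_self b (vecMul_injective_of_isUnit
    ((isUnit_iff_isUnit_det b).mpr (isUnit_det_of_upperTriangular hb hd)))

/-- **The inner inclusion.**  For `b` in the Siegel set `𝔅(c, t)` (`0 ≤ c`, `0 < t ≤ 1`), the form
`b bᴴ` lies in the convex body `V(c₁, t')` whenever `c + c² n t⁻ⁿ < c₁` and
`t' (1 + c² n t⁻ⁿ) < t`. [cite: Borel1969, §1.2–1.4] -/
theorem mul_conjTranspose_mem_sandwich {c t c₁ t' : ℝ} (hc : 0 ≤ c) (ht : 0 < t) (ht1 : t ≤ 1)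
    (hc₁ : c + c ^ 2 * n * (t⁻¹) ^ n < c₁) (ht' : t' * (1 + c ^ 2 * n * (t⁻¹) ^ n) < t)
    {b : Matrix (Fin n) (Fin n) 𝕜} (hb : b ∈ upperSiegel c t) : b * bᴴ ∈ sandwich c₁ t' := by
  have hb' := hb
  obtain ⟨htri, hdiag, hoff, hroot⟩ := hb'
  set κ : ℝ := 1 + c ^ 2 * n * (t⁻¹) ^ n with hκ
  have hκ1 : 1 ≤ κ := by
    have : 0 ≤ c ^ 2 * n * (t⁻¹) ^ n := by positivity
    linarith
  have hsd : ∀ i, schurDiag (b * bᴴ) i = ‖b i i‖ ^ 2 := schurDiag_mul_conjTranspose htri hdiag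
  have hDpos : ∀ i, 0 < ‖b i i‖ ^ 2 := fun i => pow_pos (norm_pos_iff.mpr (hdiag i)) 2
  refine ⟨posDef_mul_conjTranspose htri hdiag, fun i j hij => ?_, fun i j hij => ?_⟩
  · rw [hsd]
    have hre := re_mul_conjTranspose_apply_self_le ht ht1 hb j
    have hre0 : 0 ≤ RCLike.re ((b * bᴴ) j j) :=
      (sq_nonneg _).trans (norm_sq_le_re_mul_conjTranspose_apply_self htri j)
    rcases le_or_gt t' 0 with ht'0 | ht'0
    · exact lt_of_le_of_lt (mul_nonpos_of_nonpos_of_nonneg ht'0 hre0) (hDpos i)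
    · -- `t' Re P_jj ≤ t' κ D_j ≤ (t' κ / t) D_i < D_i`
      have h1 : t' * RCLike.re ((b * bᴴ) j j) ≤ t' * κ * ‖b j j‖ ^ 2 := by
        rw [mul_assoc]; exact mul_le_mul_of_nonneg_left hre ht'0.le
      have h2 : t * ‖b j j‖ ^ 2 ≤ ‖b i i‖ ^ 2 := hroot i j hij
      have h3 : t' * κ < t := ht'
      have h4 : t' * κ * ‖b j j‖ ^ 2 < ‖b i i‖ ^ 2 := by
        rcases (sq_nonneg ‖b j j‖).eq_or_lt with h0 | h0
        · rw [← h0, mul_zero]; exact hDpos i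
        · calc t' * κ * ‖b j j‖ ^ 2 < t * ‖b j j‖ ^ 2 := mul_lt_mul_of_pos_right h3 h0
            _ ≤ ‖b i i‖ ^ 2 := h2
      exact lt_of_le_of_lt h1 h4
  · rw [hsd]
    calc ‖(b * bᴴ) i j‖ ≤ (c + c ^ 2 * n * (t⁻¹) ^ n) * ‖b j j‖ ^ 2 :=
          norm_mul_conjTranspose_apply_le_of_mem_upperSiegel hc ht ht1 hb hij
      _ < c₁ * ‖b j j‖ ^ 2 := mul_lt_mul_of_pos_right hc₁ (hDpos j)

/-! ### The outer inclusion `V(c₁, t') ⊆ 𝔅(c*, t') · x₀` -/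

/-- **The explicit constant of the outer inclusion**: `g(0) = c₁`,
`g(m+1) = c₁ + T (m+1) g(m)²`. [folklore] -/
def outerConst (c₁ T : ℝ) : ℕ → ℝ
  | 0 => c₁
  | m + 1 => c₁ + T * (m + 1) * outerConst c₁ T m ^ 2

/-- `outerConst c₁ T 0 = c₁`. [folklore] -/
@[simp]
theorem outerConst_zero (c₁ T : ℝ) : outerConst c₁ T 0 = c₁ :=
  rfl

/-- The recursion of `outerConst`. [folklore] -/
theorem outerConst_succ (c₁ T : ℝ) (m : ℕ) :
    outerConst c₁ T (m + 1) = c₁ + T * (m + 1) * outerConst c₁ T m ^ 2 :=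
  rfl

/-- `c₁ ≤ g(m)` for `T ≥ 0`. [folklore] -/
theorem le_outerConst {c₁ T : ℝ} (hT : 0 ≤ T) (m : ℕ) : c₁ ≤ outerConst c₁ T m := by
  cases m with
  | zero => exact le_rfl
  | succ m =>
    rw [outerConst_succ]
    have : 0 ≤ T * (m + 1) * outerConst c₁ T m ^ 2 := by positivity
    linarith

/-- `0 ≤ g(m)` for `c₁, T ≥ 0`. [folklore] -/
theorem outerConst_nonneg {c₁ T : ℝ} (hc₁ : 0 ≤ c₁) (hT : 0 ≤ T) (m : ℕ) :
    0 ≤ outerConst c₁ T m :=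
  hc₁.trans (le_outerConst hT m)

/-- `g` is monotone for `c₁, T ≥ 0`. [folklore] -/
theorem outerConst_mono {c₁ T : ℝ} (hc₁ : 0 ≤ c₁) (hT : 0 ≤ T) : Monotone (outerConst c₁ T) := by
  refine monotone_nat_of_le_succ fun m => ?_
  induction m with
  | zero =>
    rw [outerConst_succ, outerConst_zero]
    have : 0 ≤ T * (((0 : ℕ) : ℝ) + 1) * c₁ ^ 2 := by positivity
    linarith
  | succ m ih =>
    rw [outerConst_succ, outerConst_succ c₁ T (m + 1)]
    have h0 : 0 ≤ outerConst c₁ T m := outerConst_nonneg hc₁ hT m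
    have h1 : outerConst c₁ T m ^ 2 ≤ outerConst c₁ T (m + 1) ^ 2 := pow_le_pow_left₀ h0 ih 2
    have h2 : T * (m + 1) * outerConst c₁ T m ^ 2 ≤ T * ((m + 1 : ℕ) + 1) * outerConst c₁ T (m + 1) ^ 2 := by
      refine mul_le_mul (mul_le_mul_of_nonneg_left ?_ hT) h1 (sq_nonneg _) (by positivity)
      push_cast; linarith
    linarith

/-- **The outer inclusion.**  Let `b` be upper triangular with non-zero diagonal and suppose
`b bᴴ ∈ V(c₁, t')` with `0 ≤ c₁`, `0 < t' ≤ 1`.  Then `b ∈ 𝔅(c*, t')` with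
`c* = outerConst c₁ t'⁻ⁿ n`: the root bounds come from `t' Re P_{i+1,i+1} < d_i(P) = |b_{ii}|²` and
`|b_{i+1,i+1}|² ≤ Re P_{i+1,i+1}`, the unipotent bounds by downward induction on the columns
from `|b_{ij}| |b_{jj}| ≤ |P_{ij}| + ∑_{k>j} |b_{ik}| |b_{jk}|`. [cite: Borel1969, §1.2–1.4] -/
theorem mem_upperSiegel_of_mul_conjTranspose_mem_sandwich {c₁ t' : ℝ} (hc₁ : 0 ≤ c₁)
    (ht' : 0 < t') (ht'1 : t' ≤ 1) {b : Matrix (Fin n) (Fin n) 𝕜} (hb : b.BlockTriangular id)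
    (hd : ∀ i, b i i ≠ 0) (hP : b * bᴴ ∈ sandwich c₁ t') :
    b ∈ upperSiegel (outerConst c₁ ((t'⁻¹) ^ n) n) t' := by
  obtain ⟨-, hC, hL⟩ := hP
  set T : ℝ := (t'⁻¹) ^ n with hT
  have hT0 : 0 ≤ T := pow_nonneg (inv_nonneg.mpr ht'.le) n
  have hsd : ∀ i, schurDiag (b * bᴴ) i = ‖b i i‖ ^ 2 := schurDiag_mul_conjTranspose hb hd
  have hDpos : ∀ i, 0 < ‖b i i‖ ^ 2 := fun i => pow_pos (norm_pos_iff.mpr (hd i)) 2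
  -- the root bounds
  have hroot : ∀ i j : Fin n, (j : ℕ) = i + 1 → t' * ‖b j j‖ ^ 2 ≤ ‖b i i‖ ^ 2 := by
    intro i j hij
    have h1 := hC i j hij
    rw [hsd] at h1
    have h2 : t' * ‖b j j‖ ^ 2 ≤ t' * RCLike.re ((b * bᴴ) j j) :=
      mul_le_mul_of_nonneg_left (norm_sq_le_re_mul_conjTranspose_apply_self hb j) ht'.le
    exact (h2.trans h1.le)
  have hchain : ∀ j k : Fin n, j ≤ k → ‖b k k‖ ^ 2 ≤ T * ‖b j j‖ ^ 2 := fun j k hjk =>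
    le_inv_pow_mul_of_chain (D := fun i => ‖b i i‖ ^ 2) ht' ht'1 (fun _ => sq_nonneg _) hroot hjk
  -- the basic estimate `|b_ij| |b_jj| ≤ |P_ij| + ∑_{k>j} |b_ik| |b_jk|`
  have hbasic : ∀ i j : Fin n, i < j → ‖b i j‖ * ‖b j j‖ <
      c₁ * ‖b j j‖ ^ 2 + ∑ k ∈ Finset.univ.filter (fun k : Fin n => j < k), ‖b i k‖ * ‖b j k‖ := by
    intro i j hij
    have h1 : (b * bᴴ) i j = b i j * star (b j j) +
        ∑ k ∈ Finset.univ.filter (fun k : Fin n => j < k), b i k * star (b j k) := by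
      rw [mul_conjTranspose_apply_eq_sum_filter hb, filter_le_eq, Finset.sum_insert (notMem_filter_lt j)]
    have h2 : b i j * star (b j j) = (b * bᴴ) i j -
        ∑ k ∈ Finset.univ.filter (fun k : Fin n => j < k), b i k * star (b j k) := by
      rw [h1]; ring
    have h3 : ‖b i j‖ * ‖b j j‖ = ‖b i j * star (b j j)‖ := by rw [norm_mul, norm_star]
    rw [h3, h2]
    refine lt_of_le_of_lt (norm_sub_le _ _) ?_
    have h4 : ‖(b * bᴴ) i j‖ < c₁ * ‖b j j‖ ^ 2 := by rw [← hsd]; exact hL i j hij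
    have h5 : ‖∑ k ∈ Finset.univ.filter (fun k : Fin n => j < k), b i k * star (b j k)‖ ≤
        ∑ k ∈ Finset.univ.filter (fun k : Fin n => j < k), ‖b i k‖ * ‖b j k‖ :=
      (norm_sum_le _ _).trans (Finset.sum_le_sum fun k _ => by rw [norm_mul, norm_star])
    linarith
  -- downward induction on the columns
  have key : ∀ m : ℕ, ∀ j : Fin n, n ≤ (j : ℕ) + 1 + m → ∀ i, i < j →
      ‖b i j‖ ≤ outerConst c₁ T m * ‖b j j‖ := by
    intro m
    induction m with
    | zero =>
      intro j hj i hij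
      have hempty : Finset.univ.filter (fun k : Fin n => j < k) = ∅ := by
        ext k
        simp only [Finset.mem_filter, Finset.mem_univ, true_and, Finset.notMem_empty, iff_false,
          not_lt]
        have := k.2
        exact Fin.le_def.mpr (by omega)
      have h := hbasic i j hij
      rw [hempty, Finset.sum_empty, add_zero, outerConst_zero] at *
      have hjj : 0 < ‖b j j‖ := norm_pos_iff.mpr (hd j)
      have : ‖b i j‖ < c₁ * ‖b j j‖ := by
        have h' : ‖b i j‖ * ‖b j j‖ < c₁ * ‖b j j‖ * ‖b j j‖ := by rw [mul_assoc, ← sq]; exact h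
        exact lt_of_mul_lt_mul_right h' hjj.le
      exact this.le
    | succ m ih =>
      intro j hj i hij
      set g : ℝ := outerConst c₁ T m with hg
      have hg0 : 0 ≤ g := outerConst_nonneg hc₁ hT0 m
      have hsum : ∑ k ∈ Finset.univ.filter (fun k : Fin n => j < k), ‖b i k‖ * ‖b j k‖ ≤
          ∑ _k ∈ Finset.univ.filter (fun k : Fin n => j < k), g ^ 2 * T * ‖b j j‖ ^ 2 := by
        refine Finset.sum_le_sum fun k hk => ?_
        have hjk : j < k := (Finset.mem_filter.mp hk).2
        have hik : i < k := hij.trans hjk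
        have hk : n ≤ (k : ℕ) + 1 + m := by
          have := Fin.lt_def.mp hjk; omega
        calc ‖b i k‖ * ‖b j k‖ ≤ g * ‖b k k‖ * (g * ‖b k k‖) :=
              mul_le_mul (ih k hk i hik) (ih k hk j hjk) (norm_nonneg _)
                (mul_nonneg hg0 (norm_nonneg _))
          _ = g ^ 2 * ‖b k k‖ ^ 2 := by ring
          _ ≤ g ^ 2 * (T * ‖b j j‖ ^ 2) := mul_le_mul_of_nonneg_left (hchain j k hjk.le) (sq_nonneg g)
          _ = g ^ 2 * T * ‖b j j‖ ^ 2 := by ring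
      rw [Finset.sum_const, nsmul_eq_mul] at hsum
      have hcard : ((Finset.univ.filter fun k : Fin n => j < k).card : ℝ) ≤ m + 1 := by
        refine (card_filter_lt_le (n := n) j).trans ?_
        have h1 : (n : ℝ) ≤ (j : ℕ) + 1 + ((m : ℝ) + 1) := by exact_mod_cast hj
        linarith
      have hnn : 0 ≤ g ^ 2 * T * ‖b j j‖ ^ 2 := by positivity
      have h := hbasic i j hij
      have htot : ‖b i j‖ * ‖b j j‖ < outerConst c₁ T (m + 1) * ‖b j j‖ ^ 2 := by
        rw [outerConst_succ, ← hg]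
        calc ‖b i j‖ * ‖b j j‖
            < c₁ * ‖b j j‖ ^ 2 + ((Finset.univ.filter fun k : Fin n => j < k).card : ℝ) *
                (g ^ 2 * T * ‖b j j‖ ^ 2) := by linarith
          _ ≤ c₁ * ‖b j j‖ ^ 2 + (m + 1 : ℝ) * (g ^ 2 * T * ‖b j j‖ ^ 2) := by
              linarith [mul_le_mul_of_nonneg_right hcard hnn]
          _ = (c₁ + T * (m + 1) * g ^ 2) * ‖b j j‖ ^ 2 := by ring
      have hjj : 0 < ‖b j j‖ := norm_pos_iff.mpr (hd j)
      have : ‖b i j‖ < outerConst c₁ T (m + 1) * ‖b j j‖ := by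
        have h' : ‖b i j‖ * ‖b j j‖ < outerConst c₁ T (m + 1) * ‖b j j‖ * ‖b j j‖ := by
          rw [mul_assoc, ← sq]; exact htot
        exact lt_of_mul_lt_mul_right h' hjj.le
      exact this.le
  refine ⟨hb, hd, fun i j hij => key n j (by omega) i hij, hroot⟩

end PosForm

end Literature.NumberTheory.Automorphic
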